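import Summits.HodgeConjecture.HodgeConjecture.Theorems.PadicSemiregularLiftHodgeAbelianVarietiesAndreKerComponent

/-!
# Crux `HodgeAbelianVarieties` (stmt-HodgeConjecture-1333), line `cm-pivot-andre` — helper W10: the masked component of a rational `(p, q)`-class

Helper W10 toward the registered stub `stub_andreSplitWeilCM` (André's decomposition with CM
targets) of the skeleton `Cruxes/HodgeAbelianVarieties/Lines/cm_pivot_andre.lean`. On
`Hᵏ(B(ℂ); ℂ)` with a basis `Bw` (the wedge basis), the lead has finitely many operators
`Q r` (`r : Fin m`), `ℚ`-combinations of pull-backs along endomorphisms of `B` — so they preserve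
rational classes and every Hodge type — which are DIAGONAL on `Bw` with eigenvalues `q r S`. The
`E`-Weil component of a class `y` is its *masked* part
`y_D = Σ_{S : ∀ r, q r S = 0} (Bw.repr y S) • Bw S`. This file proves: `y_D` is rational if `y` is,
and of Hodge type `(p, q₀)` if `y` is (`masked_component_rational_hodge`).

Proof. For ONE diagonal operator `Q` with zero-set `Z = {S | q S = 0}` the mask
`Σ_{S ∈ Z} repr y S • Bw S` lies in `ker Q`, the complementary mask lies in `im Q`
(`Bw S = Q ((q S)⁻¹ • Bw S)` off `Z`), the two add up to `y` (`Basis.sum_repr`), and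
`ker Q ⊓ im Q = ⊥` (in coordinates `Q` multiplies the `S`-th coordinate by `q S`); so the landed
one-operator lemma `isRationalClass_and_isOfHodgeType_of_ker_component` applies
(`masked_component_one`). Then induct on the number `m` of operators: the mask for `Q 0` of the
mask for `Q 1, …, Q m` of `y` is the joint mask, because the coordinates of a masked vector are
`repr (mask_Z y) S = if S ∈ Z then repr y S else 0` (`repr_sum_smul_basis_apply`).

## References

* [VoisinHodgeI2002] C. Voisin, Hodge Theory and Complex Algebraic Geometry I, CUP 2002, §7.1.1
  (`Hᵏ(X, ℚ) ⊗ ℂ = Hᵏ(X, ℂ)`; the `H^{p,q}` are complex subspaces), §11.3.2 (actions of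
  correspondences preserve rational classes and Hodge types).
* [Andre1992] Y. André, Une remarque à propos des cycles de Hodge de type CM, Sém. Théorie des
  Nombres Paris 1989–90, Progr. Math. 102 (1992), 1–7.
-/

set_option linter.dupNamespace false

noncomputable section

namespace Summit.HodgeConjecture.HodgeConjecture.Theorems.HodgeAbelianVarieties.CMPivotAndre

open Literature.AlgebraicTopology.SingularHomology
open Literature.AlgebraicGeometry Literature.AlgebraicGeometry.HodgeTheory

/-- **Coordinates of a masked vector**: in a basis `b`, the `T`-th coordinate of
`Σ_{S ∈ s} f S • b S` is `f T` if `T ∈ s` and `0` otherwise. [folklore] -/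
theorem repr_sum_smul_basis_apply {K V J : Type*} [Semiring K] [AddCommMonoid V] [Module K V]
    [DecidableEq J] (b : Module.Basis J K V) (s : Finset J) (f : J → K) (T : J) :
    b.repr (∑ S ∈ s, f S • b S) T = if T ∈ s then f T else 0 := by
  simp only [map_sum, map_smul, Module.Basis.repr_self, Finsupp.smul_single, smul_eq_mul,
    mul_one, Finsupp.finsetSum_apply, Finsupp.single_apply]
  rw [Finset.sum_ite_eq']

/-- **Coordinates of the image under a diagonal operator**: if `Q (b S) = q S • b S` for every
basis vector, then the `T`-th coordinate of `Q z` is `q T` times the `T`-th coordinate of `z`.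
[folklore] -/
theorem repr_apply_of_diagonal {K V J : Type*} [Field K] [AddCommGroup V] [Module K V]
    [Fintype J] (b : Module.Basis J K V) (Q : V →ₗ[K] V) (q : J → K)
    (hQ : ∀ S, Q (b S) = q S • b S) (z : V) (T : J) :
    b.repr (Q z) T = q T * b.repr z T := by
  classical
  conv_lhs => rw [← b.sum_repr z]
  simp only [map_sum, map_smul, hQ, Module.Basis.repr_self, Finsupp.smul_single, smul_eq_mul,
    mul_one, Finsupp.finsetSum_apply, Finsupp.single_apply]
  rw [Finset.sum_ite_eq', if_pos (Finset.mem_univ T), mul_comm]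

/-- **A diagonalisable operator has `ker Q ⊓ im Q = ⊥`**: if `Q` is diagonal in a finite basis,
then a vector `Q z` killed by `Q` has coordinates `q T · repr z T` with `q T ^ 2 · repr z T = 0`,
hence vanishes. [folklore] -/
theorem disjoint_ker_range_of_diagonal {K V J : Type*} [Field K] [AddCommGroup V] [Module K V]
    [Fintype J] (b : Module.Basis J K V) (Q : V →ₗ[K] V) (q : J → K)
    (hQ : ∀ S, Q (b S) = q S • b S) : Disjoint (LinearMap.ker Q) (LinearMap.range Q) := by
  refine Submodule.disjoint_def.2 fun x hx₁ hx₂ ↦ ?_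
  obtain ⟨z, rfl⟩ := LinearMap.mem_range.1 hx₂
  rw [LinearMap.mem_ker] at hx₁
  refine b.ext_elem fun T ↦ ?_
  have h := congrArg (fun v ↦ b.repr v T) hx₁
  simp only [repr_apply_of_diagonal b Q q hQ, map_zero, Finsupp.zero_apply] at h ⊢
  rcases mul_eq_zero.1 h with h0 | h0
  · rw [h0, zero_mul]
  · exact h0

/-- **One diagonal operator: the mask onto the eigenvalue `0` is the kernel component** (helper
toward W10). For `X` smooth projective, a basis `Bw` of `Hᵏ(X(ℂ); ℂ)` and a complex-linear `Q`
preserving rational classes and Hodge types with `Q (Bw S) = q S • Bw S`: the mask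
`Σ_{q S = 0} repr y S • Bw S` of `y` is rational if `y` is and of type `(p, q₀)` if `y` is — it is
the `ker Q`-component of `y` in `Hᵏ = ker Q ⊕ im Q`, and
`isRationalClass_and_isOfHodgeType_of_ker_component` applies. [cite: VoisinHodgeI2002, §7.1.1] -/
theorem masked_component_one {n : ℕ} {X : Motives.SchemeOver ℂ} (hX : Motives.IsSmoothProjective n X)
    {k : ℕ} {J : Type} [Fintype J] [DecidableEq J] (Bw : Module.Basis J ℂ (complexBetti X k))
    (Q : complexBetti X k →ₗ[ℂ] complexBetti X k) (q : J → ℂ)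
    (hQrat : ∀ c, IsRationalClass c → IsRationalClass (Q c))
    (hQhodge : ∀ (p q₀ : ℕ) c, IsOfHodgeType n X k p q₀ c → IsOfHodgeType n X k p q₀ (Q c))
    (hdiag : ∀ S, Q (Bw S) = q S • Bw S) (y : complexBetti X k) :
    (IsRationalClass y →
      IsRationalClass (∑ S ∈ Finset.univ.filter (fun S => q S = 0), Bw.repr y S • Bw S)) ∧
    (∀ p q₀ : ℕ, IsOfHodgeType n X k p q₀ y →
      IsOfHodgeType n X k p q₀ (∑ S ∈ Finset.univ.filter (fun S => q S = 0), Bw.repr y S • Bw S)) := by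
  refine isRationalClass_and_isOfHodgeType_of_ker_component hX Q hQrat hQhodge
    (disjoint_ker_range_of_diagonal Bw Q q hdiag) y _
    (∑ S ∈ Finset.univ.filter (fun S => ¬ q S = 0), Bw.repr y S • Bw S) ?_ ?_ ?_
  · -- the mask lies in `ker Q`
    rw [LinearMap.mem_ker, map_sum]
    refine Finset.sum_eq_zero fun S hS ↦ ?_
    rw [map_smul, hdiag, (Finset.mem_filter.1 hS).2, zero_smul, smul_zero]
  · -- the complementary mask lies in `im Q`
    refine LinearMap.mem_range.2
      ⟨∑ S ∈ Finset.univ.filter (fun S => ¬ q S = 0), (Bw.repr y S * (q S)⁻¹) • Bw S, ?_⟩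
    rw [map_sum]
    refine Finset.sum_congr rfl fun S hS ↦ ?_
    rw [map_smul, hdiag, smul_smul, mul_assoc, inv_mul_cancel₀ (Finset.mem_filter.1 hS).2, mul_one]
  · -- the two masks add up to `y`
    rw [Finset.sum_filter_add_sum_filter_not, Bw.sum_repr]

/-- **The masked component of a rational `(p, q₀)`-class is rational and of type `(p, q₀)`**
(helper W10 of line `cm-pivot-andre`). For `X` smooth projective of dimension `n`, a basis `Bw` of
`Hᵏ(X(ℂ); ℂ)` and finitely many complex-linear operators `Q r` (`r : Fin m`) which map rational
classes to rational classes and classes of type `(p, q₀)` to classes of type `(p, q₀)` (e.g.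
`ℚ`-combinations of pull-backs along endomorphisms, Voisin I §11.3.2) and are diagonal on `Bw`
with eigenvalues `q r S`: the joint mask `Σ_{S : ∀ r, q r S = 0} repr y S • Bw S` of a class `y` is
rational if `y` is, and of type `(p, q₀)` if `y` is. Induction on `m`: the mask for `Q 0` of the
joint mask for `Q 1, …, Q m` is the joint mask for all of them (coordinates of a masked vector,
`repr_sum_smul_basis_apply`), and each single mask preserves rationality and Hodge type
(`masked_component_one`, from `isRationalClass_and_isOfHodgeType_of_ker_component`).
[cite: VoisinHodgeI2002, §7.1.1] -/
theorem masked_component_rational_hodge : ∀ {n : ℕ} {X : Literature.AlgebraicGeometry.Motives.SchemeOver ℂ}, Literature.AlgebraicGeometry.Motives.IsSmoothProjective n X → ∀ {k m : ℕ} {J : Type} [Fintype J] [DecidableEq J] (Bw : Module.Basis J ℂ (Literature.AlgebraicGeometry.HodgeTheory.complexBetti X k)) (Q : Fin m → (Literature.AlgebraicGeometry.HodgeTheory.complexBetti X k →ₗ[ℂ] Literature.AlgebraicGeometry.HodgeTheory.complexBetti X k)) (q : Fin m → J → ℂ), (∀ r c, Literature.AlgebraicGeometry.HodgeTheory.IsRationalClass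 c → Literature.AlgebraicGeometry.HodgeTheory.IsRationalClass (Q r c)) → (∀ r (p q0 : ℕ) c, Literature.AlgebraicGeometry.HodgeTheory.IsOfHodgeType n X k p q0 c → Literature.AlgebraicGeometry.HodgeTheory.IsOfHodgeType n X k p q0 (Q r c)) → (∀ r S, Q r (Bw S) = q r S • Bw S) → ∀ y : Literature.AlgebraicGeometry.HodgeTheory.complexBetti X k, (Literature.AlgebraicGeometry.HodgeTheory.IsRationalClass y → Literature.AlgebraicGeometry.HodgeTheory.IsRationalClass (∑ S ∈ Finset.univ.filter (fun S => ∀ r, q r S = 0), Bw.repr y S • Bw S)) ∧ (∀ p q0 : ℕ, Literature.AlgebraicGeometry.HodgeTheory.IsOfHodgeType n X k p q0 y → Literature.AlgebraicGeometry.HodgeTheory.IsOfHodgeType n X k p q0 (∑ S ∈ Finset.univ.filter (fun S => ∀ r, q r S = 0), Bw.repr y S • Bw S)) := by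
  intro n X hX k m
  induction m with
  | zero =>
    intro J _ _ Bw Q q _ _ _ y
    have e : (∑ S ∈ Finset.univ.filter (fun S => ∀ r : Fin 0, q r S = 0), Bw.repr y S • Bw S) = y := by
      rw [Finset.filter_true_of_mem (fun S _ r ↦ r.elim0), Bw.sum_repr]
    rw [e]
    exact ⟨id, fun _ _ ↦ id⟩
  | succ m ih =>
    intro J _ _ Bw Q q hQrat hQhodge hdiag y
    -- the joint mask for the operators `Q 1, …, Q m`
    set y' : complexBetti X k :=
      ∑ S ∈ Finset.univ.filter (fun S => ∀ r : Fin m, q r.succ S = 0), Bw.repr y S • Bw S with hy'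
    have h₁ := ih Bw (fun r ↦ Q r.succ) (fun r ↦ q r.succ) (fun r ↦ hQrat r.succ)
      (fun r ↦ hQhodge r.succ) (fun r ↦ hdiag r.succ) y
    -- followed by the mask for `Q 0`
    have h₂ := masked_component_one hX Bw (Q 0) (q 0) (hQrat 0) (hQhodge 0) (hdiag 0) y'
    -- is the joint mask for all of them
    have e : (∑ S ∈ Finset.univ.filter (fun S => q 0 S = 0), Bw.repr y' S • Bw S) =
        ∑ S ∈ Finset.univ.filter (fun S => ∀ r : Fin (m + 1), q r S = 0), Bw.repr y S • Bw S := by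
      rw [Finset.sum_filter, Finset.sum_filter]
      refine Finset.sum_congr rfl fun S _ ↦ ?_
      rw [hy', repr_sum_smul_basis_apply]
      by_cases h0 : q 0 S = 0
      · by_cases hs : ∀ r : Fin m, q r.succ S = 0
        · rw [if_pos h0, if_pos (Finset.mem_filter.2 ⟨Finset.mem_univ S, hs⟩),
            if_pos (Fin.forall_fin_succ.2 ⟨h0, hs⟩)]
        · rw [if_pos h0, if_neg (fun h ↦ hs (Finset.mem_filter.1 h).2), zero_smul,
            if_neg (fun h ↦ hs (Fin.forall_fin_succ.1 h).2)]
      · rw [if_neg h0, if_neg (fun h ↦ h0 (Fin.forall_fin_succ.1 h).1)]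
    rw [← e]
    exact ⟨fun hy ↦ h₂.1 (h₁.1 hy), fun p q0 hy ↦ h₂.2 p q0 (h₁.2 p q0 hy)⟩

end Summit.HodgeConjecture.HodgeConjecture.Theorems.HodgeAbelianVarieties.CMPivotAndre

end
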